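import Mathlib

/-!
# The Bogolyubov–Ruzsa lemma for finite fields (Sanders), density form

Sanders [Sanders2012, Theorem 20] («Bogolyubov-Ruzsa Lemma for finite fields», arXiv:1011.0107 p. 18, as printed):
*Suppose `A, S ⊂ 𝔽_qⁿ` are finite non-empty sets such that `|A+S| ≤ K min{|A|,|S|}`.  Then `(A−A)+(S−S)` contains a (proper)
subspace `V` of size `exp(−O_q(log⁴K))|A+S|`.*

We record the DENSITY COROLLARY used on the quantum-advantage summit (decomp-qadv, (c0) road (P7)(iv)): take `A = S` of density `α` in
`𝔽_pⁿ`, `K = α⁻¹` (since `|A+A| ≤ pⁿ = α⁻¹|A|`); then `|V| ≥ exp(−O_p(log⁴ α⁻¹))·α·pⁿ`, i.e. `codim V = O_p((1 + log α⁻¹)⁴)`, and `V ⊆ 2A − 2A`.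
The constant depends on `p` only.  This is an unproved-here published result: a NAMED FACT `def … : Prop`, to be used as a hypothesis.
-/

namespace Literature.Combinatorics.Additive

open Finset Module

/-- **Bogolyubov–Ruzsa lemma for finite fields, density form** (corollary of Sanders' Theorem 20 with `A = S`, `K = α⁻¹`):
for every prime `p` there is `C = C(p) > 0` such that for every `n` and every `A ⊆ 𝔽_pⁿ` with `|A| ≥ α pⁿ` (`0 < α ≤ 1`) there is a
linear subspace `V ≤ 𝔽_pⁿ` of codimension `≤ C·(1 + log α⁻¹)⁴` with `V ⊆ A + A − A − A`.
[cite: Sanders2012, Theorem 20] -/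
def bogolyubovRuzsaFiniteField : Prop :=
  ∀ (p : ℕ) [Fact p.Prime], ∃ C : ℝ, 0 < C ∧
    ∀ (n : ℕ) (A : Finset (Fin n → ZMod p)) (α : ℝ), 0 < α → α ≤ 1 → α * (p : ℝ) ^ n ≤ A.card →
      ∃ V : Submodule (ZMod p) (Fin n → ZMod p),
        ((n : ℝ) - finrank (ZMod p) V) ≤ C * (1 + Real.log (1 / α)) ^ 4 ∧
        ∀ v ∈ V, ∃ a₁ ∈ A, ∃ a₂ ∈ A, ∃ a₃ ∈ A, ∃ a₄ ∈ A, v = a₁ + a₂ - a₃ - a₄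

end Literature.Combinatorics.Additive
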